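import Mathlib
import Literature.Computability.AlgebraicComplexity.HessianAtOrigin
import Literature.Computability.AlgebraicComplexity.MignonRessayreBound

/-!
# Crux `GrenetZeon.TwoDimCoefficients` (stmt-ValiantsHypothesis-8062), stub `stub_dualUnipotent`:
# the unipotent trace model is Hessian-blind

The line `dim2_cases` isolates as its hardest stub the sub-case
`per_n = α·det A + β·tr(adj A · B)`, `det A ≡ c ≠ 0`, of a dual-number representation, and asks
for `n² ≤ C·m` there (`DualUnipotentBound`).  Every other case of the crux is settled by the
Mignon–Ressayre mechanism: for ONE affine determinant, `(det A)(0) = 0` forces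
`rank Hess₀(det A) ≤ 2m` (tree: `rank_hess0_det_le`), against `rank Hess per_n = n²` at a good
point.  This file proves that the analogous pointwise statement for the unipotent trace model is
FALSE with any constant, so that no argument of that shape can close the stub:

* `not_hessianRankBound_unipotentTrace`: there is no `C` such that for all affine `m × m`
  matrices `A`, `B` over `ℂ[x_σ]` with `det A = 1` and `tr(adj A · B)(0) = 0` one has
  `rank Hess₀(tr(adj A · B)) ≤ C·m`.

Witness (size `m = 2w`, `w²` variables `x_{ab}`): `A = [[1, −X], [0, 1]]`, `B = [[0, 0], [Xᵀ, 0]]`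
with `X = (x_{ab})`; then `det A = 1`, `adj A = A⁻¹ = [[1, X], [0, 1]]`,
`tr(adj A · B) = tr(X·Xᵀ) = Σ_{a,b} x_{ab}²`, whose Hessian at the origin is `2·1` of rank
`w² = m²/4` (so the model's transfer constant `dc ≤ m² + 1` of
`GrenetZeonTwoDimCoefficientsDualUnipotentCalibration` is sharp up to the factor `4`, and a
bound `rank ≤ C·m` fails as soon as `w > 2C`).

HONEST FRAMING: a statement about the METHOD (pointwise Hessian rank), not about the permanent;
it neither proves nor refutes `DualUnipotentBound`, which stays open; `VP ≠ VNP` is not moved.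

References: T. Mignon, N. Ressayre, Int. Math. Res. Not. 2004:79, Thm. 1.1 and §2 (the
single-determinant rank bound this file contrasts with).
-/

-- single-conjunct layout `Summits/ValiantsHypothesis/ValiantsHypothesis`: the duplicated namespace
-- component is mandated by the tree.
set_option linter.dupNamespace false

noncomputable section

namespace Summit.ValiantsHypothesis.ValiantsHypothesis.Cruxes.TwoDimCoefficients.DimTwoCases

open Literature.Computability.AlgebraicComplexity Matrix MvPolynomial

section HessLemmas

variable {σ : Type} [DecidableEq σ]

/-- The linear part of a variable: `∇(x_u)(0) = e_u`. [folklore] -/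
theorem linPart_X (u : σ) : linPart (X u : MvPolynomial σ ℂ) = Pi.single u 1 := by
  funext s
  rw [linPart_apply, pderiv_X]
  by_cases h : s = u
  · subst h
    simp
  · rw [Pi.single_eq_of_ne (Ne.symm h), Pi.single_eq_of_ne h, map_zero]

/-- The Hessian at the origin of a product of two variables: `Hess₀(x_u x_v) = E_{uv} + E_{vu}`.
[folklore] -/
theorem hess0_X_mul_X (u v : σ) :
    hess0 (X u * X v : MvPolynomial σ ℂ) =
      vecMulVec (Pi.single u (1 : ℂ)) (Pi.single v 1) + vecMulVec (Pi.single v (1 : ℂ)) (Pi.single u 1) := by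
  rw [hess0_mul, hess0_eq_zero_of_totalDegree_le_one (totalDegree_X u).le,
    hess0_eq_zero_of_totalDegree_le_one (totalDegree_X v).le, constantCoeff_X, constantCoeff_X,
    linPart_X, linPart_X]
  simp

variable [Fintype σ]

/-- The Hessian at the origin of the sum of squares of all variables is `2·1`. [folklore] -/
theorem hess0_sum_X_sq :
    hess0 (∑ u : σ, (X u * X u : MvPolynomial σ ℂ)) = (2 : ℂ) • (1 : Matrix σ σ ℂ) := by
  rw [map_sum]
  ext s t
  simp only [Matrix.sum_apply, hess0_X_mul_X, Matrix.add_apply, vecMulVec_apply,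
    Matrix.smul_apply, Matrix.one_apply, smul_eq_mul]
  by_cases h : s = t
  · subst h
    rw [Finset.sum_eq_single s]
    · simp
      ring
    · intro u _ hu
      simp [Pi.single_eq_of_ne (Ne.symm hu)]
    · simp
  · rw [Finset.sum_eq_zero]
    · simp [h]
    · intro u _
      by_cases hu : s = u
      · subst hu
        simp [Pi.single_eq_of_ne (Ne.symm h)]
      · simp [Pi.single_eq_of_ne hu]

/-- `rank (2·1) = #σ` over `ℂ`. [folklore] -/
theorem rank_two_smul_one : ((2 : ℂ) • (1 : Matrix σ σ ℂ)).rank = Fintype.card σ := by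
  apply Matrix.rank_of_isUnit
  rw [Matrix.isUnit_iff_isUnit_det, Matrix.det_smul, Matrix.det_one, mul_one]
  exact isUnit_iff_ne_zero.mpr (pow_ne_zero _ two_ne_zero)

end HessLemmas

/-! ### The witness -/

section Witness

variable (w : ℕ)

/-- The trace of a reindexed square matrix. [folklore] -/
theorem trace_submatrix_equiv {R : Type} [AddCommMonoid R] {ι κ : Type} [Fintype ι] [Fintype κ]
    (e : ι ≃ κ) (M : Matrix κ κ R) : (M.submatrix e e).trace = M.trace :=
  Fintype.sum_equiv e _ _ fun _ => rfl

/-- The witness polynomial: with `X = (x_{ab})` the generic `w × w` matrix,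
`tr([[1, X], [0, 1]] · [[0, 0], [Xᵀ, 0]]) = Σ_{u} x_u²`. [folklore] -/
theorem trace_witness :
    (fromBlocks (1 : Matrix (Fin w) (Fin w) (MvPolynomial (Fin w × Fin w) ℂ))
        (Matrix.of fun a b => X (a, b)) 0 1 *
      fromBlocks 0 0 (Matrix.of fun a b => X (a, b))ᵀ 0).trace =
      ∑ u : Fin w × Fin w, (X u * X u : MvPolynomial (Fin w × Fin w) ℂ) := by
  rw [fromBlocks_multiply]
  simp only [Matrix.trace, Matrix.diag, Fintype.sum_sum_type, fromBlocks_apply₁₁,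
    fromBlocks_apply₂₂, Matrix.mul_zero, add_zero, Matrix.zero_apply,
    Finset.sum_const_zero, Matrix.one_mul, zero_add, Matrix.mul_apply, Matrix.transpose_apply,
    Matrix.of_apply, Fintype.sum_prod_type]

/-- The adjugate of the unipotent witness matrix `[[1, −X], [0, 1]]` is `[[1, X], [0, 1]]`.
[folklore] -/
theorem adjugate_witness {R : Type} [CommRing R] (X : Matrix (Fin w) (Fin w) R) :
    (fromBlocks (1 : Matrix (Fin w) (Fin w) R) (-X) (0 : Matrix (Fin w) (Fin w) R) 1).adjugate = fromBlocks 1 X 0 1 := by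
  have hdet : (fromBlocks (1 : Matrix (Fin w) (Fin w) R) (-X) (0 : Matrix (Fin w) (Fin w) R) 1).det = 1 := by
    rw [det_fromBlocks_zero₂₁, det_one, mul_one]
  have hinv : (fromBlocks (1 : Matrix (Fin w) (Fin w) R) (-X) (0 : Matrix (Fin w) (Fin w) R) 1)⁻¹ = fromBlocks 1 X 0 1 := by
    apply inv_eq_right_inv
    rw [fromBlocks_multiply]
    simp [fromBlocks_one]
  rw [← hinv, Matrix.inv_def, hdet, Ring.inverse_one, one_smul]

/-- **The unipotent trace model admits no pointwise Hessian-rank bound.**  There is no constant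
`C` such that `rank Hess₀(tr(adj A · B)) ≤ C·m` for all affine `m × m` matrices `A`, `B` (any
finite variable set) with `det A = 1` and `tr(adj A · B)(0) = 0` — in contrast with the
single-determinant bound `rank Hess₀(det A) ≤ 2m` of Mignon–Ressayre (`rank_hess0_det_le`) that
drives every other case of the crux `TwoDimCoefficients`.  Witness: `A = [[1, −X], [0, 1]]`,
`B = [[0, 0], [Xᵀ, 0]]` of size `2w` with `tr(adj A · B) = Σ x_{ab}²`, Hessian `2·1` of rank `w²`.
[folklore] -/
theorem not_hessianRankBound_unipotentTrace :
    ¬ ∃ C : ℕ, ∀ (σ : Type) [Fintype σ] [DecidableEq σ] (m : ℕ)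
        (A B : Matrix (Fin m) (Fin m) (MvPolynomial σ ℂ)),
        (∀ i j, (A i j).totalDegree ≤ 1) → (∀ i j, (B i j).totalDegree ≤ 1) →
        A.det = 1 → constantCoeff (A.adjugate * B).trace = 0 →
        (hess0 (A.adjugate * B).trace).rank ≤ C * m := by
  rintro ⟨C, hC⟩
  -- the witness of size `m = w + w` with `w = 2C + 1`
  set w : ℕ := 2 * C + 1 with hw
  let σ : Type := Fin w × Fin w
  let Xm : Matrix (Fin w) (Fin w) (MvPolynomial σ ℂ) := Matrix.of fun a b => X (a, b)
  let e : Fin w ⊕ Fin w ≃ Fin (w + w) := finSumFinEquiv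
  let A' : Matrix (Fin w ⊕ Fin w) (Fin w ⊕ Fin w) (MvPolynomial σ ℂ) := fromBlocks 1 (-Xm) 0 1
  let B' : Matrix (Fin w ⊕ Fin w) (Fin w ⊕ Fin w) (MvPolynomial σ ℂ) := fromBlocks 0 0 Xmᵀ 0
  have hA'aff : ∀ i j, (A' i j).totalDegree ≤ 1 := by
    rintro (i | i) (j | j)
    · simp only [A', fromBlocks_apply₁₁]
      by_cases h : i = j
      · subst h; simp
      · simp [Matrix.one_apply_ne h]
    · simp only [A', fromBlocks_apply₁₂, Matrix.neg_apply, Xm, Matrix.of_apply, totalDegree_neg]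
      exact (totalDegree_X _).le
    · simp [A']
    · simp only [A', fromBlocks_apply₂₂]
      by_cases h : i = j
      · subst h; simp
      · simp [Matrix.one_apply_ne h]
  have hB'aff : ∀ i j, (B' i j).totalDegree ≤ 1 := by
    rintro (i | i) (j | j)
    · simp [B']
    · simp [B']
    · simp only [B', fromBlocks_apply₂₁, Matrix.transpose_apply, Xm, Matrix.of_apply]
      exact (totalDegree_X _).le
    · simp [B']
  have hA'det : A'.det = 1 := by
    simp only [A']
    rw [det_fromBlocks_zero₂₁, det_one, mul_one]
  have htr : (A'.adjugate * B').trace = ∑ u : σ, (X u * X u : MvPolynomial σ ℂ) := by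
    simp only [A', B', adjugate_witness]
    exact trace_witness w
  -- instantiate the claimed bound at the reindexed witness
  have h := hC σ (w + w) (reindex e e A') (reindex e e B')
    (fun i j => hA'aff _ _) (fun i j => hB'aff _ _)
    (by rw [det_reindex_self, hA'det])
  have htr' : ((reindex e e A').adjugate * reindex e e B').trace =
      ∑ u : σ, (X u * X u : MvPolynomial σ ℂ) := by
    rw [adjugate_reindex, reindex_apply, reindex_apply, submatrix_mul_equiv,
      trace_submatrix_equiv, htr]
  rw [htr'] at h
  have h0 : constantCoeff (∑ u : σ, (X u * X u : MvPolynomial σ ℂ)) = 0 := by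
    simp [map_sum, constantCoeff_X]
  have hrank := h h0
  rw [hess0_sum_X_sq, rank_two_smul_one, Fintype.card_prod, Fintype.card_fin] at hrank
  -- `w² ≤ C (2w)` with `w = 2C + 1`: contradiction
  have : w * w ≤ C * (w + w) := hrank
  nlinarith
end Witness

end Summit.ValiantsHypothesis.ValiantsHypothesis.Cruxes.TwoDimCoefficients.DimTwoCases

end
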